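import Summits.QuantumFields.BalabanUV.T4Continuum.Support.ShellMeasureLandauHolonomyTermsEnd
import Summits.QuantumFields.BalabanUV.T4Continuum.Support.ShellMeasureLandauHolonomyToy
import Summits.QuantumFields.BalabanUV.T4Continuum.Support.ShellMeasureWilsonToy

/-!
# `T4Continuum.ShellMeasureLandauHolonomyRealToy` — NON-VACUITY of the weight side: the REAL STRUCTURE, the UNITARITY
# TYPE of the read-outs, the per-term functional data and the coupling are JOINTLY INHABITED with the S22 chain, a LIVE
# shell and (SM) — the `𝔲(1)` model (exponents on the imaginary axis)
(cell `pub-balaban`, sub-cell `t4`, spine estimate NE7c (node U5b); NE7c formalisation swarm, crew seat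
`b2b-balaban-t4-ne7c-formalise-leaf-02` gen 4 — companion TOY of files (A)–(D) of the OFFER «S22 ROAD, THE WEIGHT
SIDE»; imports (D) `ShellMeasureLandauHolonomyTermsEnd`, this lineage's gen-3 toy `ShellMeasureLandauHolonomyToy`
(p213511: `toyΦ`, numerics) and `ShellMeasureWilsonToy` (p206459: the trace datum `Re` on `ℂ`) ONLY; four DATA `def`s
(`mulI`, `imagAxis`, `realAxis`, `toyZu` — objects, not propositions), 0 `def … : Prop`, 0 sorry)

HONEST FRAMING.  A TOY: a consistency certificate of a hypothesis set, nothing about Bałaban's minimiser.  Finite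
four-torus programme, rung (B)+1 only — NOT infinite volume, NOT a mass gap, NOT the Clay problem; NE7c NOT PRINTED, NOT
PROVED; «NE7c ⇐ the named binders»; (M1) realized ≠ NE7c (c3).

WHY.  Files (A)/(B)/(D) add to the S22 END three NEW displayed binder families: the REAL STRUCTURE (closed additive
subgroups `𝓡𝒴`, `𝓡𝒳`, subgroups `𝓡𝒵`, `𝓡𝒴′`, `𝓡ℬ` preserved by `𝒢`, `W𝒱`, `ι`, `H`, `C`, `H₁`; `Φ` real at real points),
the UNITARITY TYPE of the weight read-outs (`τ (ℓ Y) = 0 ∧ ‖exp (ℓ Y)‖ ≤ 1` on `𝓡𝒴`) and the per-term functional data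
with the coupling `z̄ ≤ r_E`.  The typer's diagnostics T-NE7c-4 and T-NE7c-5 were about binder families NOT jointly inhabitable;
this file shows the new families ARE, together with 7″ §3's chain, a live shell and (SM), on the `𝔲(1)` MODEL: `n = 1`,
all spaces `ℂ`, `𝒢 = ι = id`, `W𝒱 = 0`, `C Z = Z²`, `H = H₁ = i·id` (multiplication by `i`), `Φ z = z₀/10⁴`
(`r_Φ = 200`, `S = 1`, `b = 1/50`, `ε₄ = 10⁻³`, `C₂ = 1`, `R_C = 1`), read-out `id`, trace datum `Re` (`N = 1`); real
structure `𝓡𝒴 = 𝓡𝒵 = 𝓡𝒴′ = iℝ`, `𝓡𝒳 = 𝓡ℬ = ℝ`: the exponent field `toyZu y = i·(y₀/10⁴ − D)` lies on the IMAGINARY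
AXIS (`= 𝔲(1)`), where `Re = 0` and `|exp| = 1`.
* §1 the data and the real structure (`imagAxis`, `realAxis` — closed: `isClosed_eq`; the seven preservation facts; the unitarity type of
  `id` on `iℝ`); §2 `toy_real` — (A)'s `landauField_mem_real` FIRES: `toyZu y ∈ iℝ` for `‖y‖ ≤ 1`; §3 `toy_hGW` — (B)'s
  `hGW_landau_chartRay` FIRES (END-II's `hGW` for `holOf [id] toyZu`, sizes `s̄ = z̄ = 0.022764`, `L̄ = 3z̄/199`, `d̄ = 0`);
  §4 `toy_hE` — (D)'s `hE_landau_chartRay` FIRES with ONE term `𝓔₁ = id` on `ball 0 1` (`e₁ = 1`, `H̄ = 2`, coupling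
  `z̄ ≤ 1`); §5 `toy_live_u` — a LIVE shell point `x₀ = 1` in the window at `θ = 10⁻⁴`, `ρ = 1/4`; §6 (SM) = gen 3's
  `toy_SM` verbatim (same `H_AN`), `toy_sw1` — END-II's `hsw1` (`z̄ ≤ 1`).
HONEST DEPENDENCY (cell): continuum YM on T⁴ ⇐ BetaPertH ∧ nine spine estimates (0/9 proved); BetaPertH ⇐ (D1) ∧ (D4)
∧ CAP+tail; G-an2-4 gates asym, D1 and NE2/3/4.
-/

noncomputable section

open Set Metric NormedSpace

namespace Summit.QuantumFields.BalabanUV.T4Continuum.ShellMeasureLandauHolonomyRealToy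

open Literature.MathematicalPhysics.QuantumFieldTheory.Balaban1983to89
open B11Prop6Scheme (Prop4Hyp)
open ShellMeasureWilsonWords (wordExp)
open ShellMeasureWilsonTrace (TraceData)
open ShellMeasureWilsonMoving (MLetter mwordEval mdFro sSum lSum)
open ShellMeasureLandauHolonomy (solAt corrAt landauExp corrAt_along landauExp_apply)
open ShellMeasureLandauHolonomyChart (holOf cplx holOf_apply)
open ShellMeasureLandauHolonomyReal (landauField_mem_real)
open ShellMeasureLandauHolonomyWeight (hGW_landau_chartRay)
open ShellMeasureLandauHolonomyTermsEnd (hE_landau_chartRay)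
open ShellMeasureLandauHolonomyToy (toyΦ toyΦ_apply toy_prop4 toy_id_bound toy_chartMap toy_sectC toy_solAt
  norm_exp_sub_one_ge)
open ShellMeasureWilsonToy (complexTrace)

/-! ## §1 The `𝔲(1)` model: data, real structure, unitarity type -/

/-- multiplication by `i` as a continuous `ℂ`-linear map — the model's `H` and `H₁` («real ↦ imaginary»). A map, not a
proposition. [folklore] -/
def mulI : ℂ →L[ℂ] ℂ := Complex.I • ContinuousLinearMap.id ℂ ℂ

/-- `mulI z = i·z`. [folklore] -/
@[simp] theorem mulI_apply (z : ℂ) : mulI z = Complex.I * z := by simp [mulI]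

/-- (46)/(103) TYPE for `i·id`: `‖i z‖ ≤ 1·‖z‖`. [folklore] -/
theorem mulI_bound : ∀ z : ℂ, ‖mulI z‖ ≤ 1 * ‖z‖ := fun z => by simp

/-- the IMAGINARY AXIS `iℝ ⊂ ℂ` — the model's real configurations (`𝔲(1)`: anti-Hermitian `1 × 1` matrices). A
subgroup, not a proposition. [folklore] -/
def imagAxis : AddSubgroup ℂ where
  carrier := {z | z.re = 0}
  add_mem' {a b} ha hb := by
    simp only [mem_setOf_eq] at ha hb ⊢
    rw [Complex.add_re, ha, hb, add_zero]
  zero_mem' := by simp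
  neg_mem' {a} ha := by
    simp only [mem_setOf_eq] at ha ⊢
    rw [Complex.neg_re, ha, neg_zero]

/-- the REAL AXIS `ℝ ⊂ ℂ` — the model's real corrections and coarse fields. A subgroup, not a proposition. [folklore] -/
def realAxis : AddSubgroup ℂ where
  carrier := {z | z.im = 0}
  add_mem' {a b} ha hb := by
    simp only [mem_setOf_eq] at ha hb ⊢
    rw [Complex.add_im, ha, hb, add_zero]
  zero_mem' := by simp
  neg_mem' {a} ha := by
    simp only [mem_setOf_eq] at ha ⊢
    rw [Complex.neg_im, ha, neg_zero]

/-- membership in `iℝ`. [folklore] -/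
theorem mem_imagAxis {z : ℂ} : z ∈ imagAxis ↔ z.re = 0 := Iff.rfl

/-- membership in `ℝ`. [folklore] -/
theorem mem_realAxis {z : ℂ} : z ∈ realAxis ↔ z.im = 0 := Iff.rfl

/-- `i·(real) ∈ iℝ`. [folklore] -/
theorem mulI_mem_imagAxis {z : ℂ} (hz : z ∈ realAxis) : mulI z ∈ imagAxis := by
  rw [mem_realAxis] at hz
  rw [mem_imagAxis, mulI_apply, Complex.mul_re, Complex.I_re, Complex.I_im, hz]
  ring

/-- `(imaginary)² ∈ ℝ`. [folklore] -/
theorem sq_mem_realAxis {z : ℂ} (hz : z ∈ imagAxis) : z ^ 2 ∈ realAxis := by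
  rw [mem_imagAxis] at hz
  rw [mem_realAxis, sq, Complex.mul_im, hz]
  ring

/-- the toy chart map is REAL AT REAL POINTS: `Φ (cplx y) = y₀/10⁴ ∈ ℝ`. [folklore] -/
theorem toyΦ_real (y : Fin 1 → ℝ) : toyΦ (cplx y) ∈ realAxis := by
  rw [mem_realAxis, toyΦ_apply, cplx, Complex.mul_im, Complex.ofReal_re, Complex.ofReal_im]
  norm_num

/-- **THE SEVEN PRESERVATION FACTS** of file (A)'s real structure on the model: `𝒢 = id : iℝ → iℝ`, `W𝒱 = 0 : iℝ → iℝ`,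
`ι = id : iℝ → iℝ`, `H = i·id : ℝ → iℝ`, `C = (·)² : iℝ → ℝ`, `H₁ = i·id : ℝ → iℝ`, `Φ` real at real points. [folklore] -/
theorem toy_realStructure :
    (∀ f ∈ imagAxis, (ContinuousLinearMap.id ℂ ℂ) f ∈ imagAxis) ∧
    (∀ Y ∈ imagAxis, (fun _ : ℂ => (0 : ℂ)) Y ∈ imagAxis) ∧
    (∀ Y ∈ imagAxis, (ContinuousLinearMap.id ℂ ℂ) Y ∈ imagAxis) ∧
    (∀ X ∈ realAxis, mulI X ∈ imagAxis) ∧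
    (∀ Z ∈ imagAxis, (fun Z : ℂ => Z ^ 2) Z ∈ realAxis) ∧
    (∀ B ∈ realAxis, mulI B ∈ imagAxis) ∧
    (∀ y : Fin 1 → ℝ, ‖y‖ ≤ 1 → toyΦ (cplx y) ∈ realAxis) :=
  ⟨fun f hf => by simpa using hf, fun _ _ => imagAxis.zero_mem, fun Y hY => by simpa using hY,
    fun _ hX => mulI_mem_imagAxis hX, fun _ hZ => sq_mem_realAxis hZ, fun _ hB => mulI_mem_imagAxis hB,
    fun y _ => toyΦ_real y⟩

/-- **THE UNITARITY TYPE OF THE READ-OUT `id` ON `iℝ`**: `Re Y = 0` and `|e^{Y}| = 1` for `Y ∈ iℝ` — (176) on the model.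
[folklore] -/
theorem toy_unitary : ∀ p ∈ ({()} : Finset Unit), ∀ ℓ ∈ [ContinuousLinearMap.id ℂ ℂ], ∀ Y ∈ imagAxis,
    complexTrace.τ (ℓ Y) = 0 ∧ ‖exp (ℓ Y)‖ ≤ 1 := by
  intro p _ ℓ hℓ Y hY
  rw [List.mem_singleton] at hℓ
  subst hℓ
  rw [mem_imagAxis] at hY
  refine ⟨by simpa [complexTrace] using hY, le_of_eq ?_⟩
  have e : Y = (Y.im : ℂ) * Complex.I := Complex.ext (by simp [hY]) (by simp)
  rw [ContinuousLinearMap.coe_id', id_eq, e, ← Complex.exp_eq_exp_ℂ, Complex.norm_exp_ofReal_mul_I]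

/-- the model's canonical Landau exponent field — file 7″ §3's `fun y => landauExp … (solAt … + …)` at the `𝔲(1)` data
(`C Z = Z²`, `ι = 𝒢 = id`, `H = H₁ = i·id`, `W = 0`, `Λ = 0`, `J = 0`, `ε₄ = 10⁻³`, `r = 4(ε₄ + b)²`). A function, not a
proposition. [folklore] -/
def toyZu (y : Fin 1 → ℝ) : ℂ :=
  landauExp (fun Z : ℂ => Z ^ 2) (ContinuousLinearMap.id ℂ ℂ) mulI (4 * 1 * (1 / 1000 + 1 * (1 / 50)) ^ 2)
    (solAt (ContinuousLinearMap.id ℂ ℂ) 0 (fun _ : ℂ => (0 : ℂ)) (1 / 1000) (0 : ℂ) (mulI (toyΦ (cplx y))) +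
      mulI (toyΦ (cplx y)))

/-! ## §2 File (A) fires: the exponent field lies on the imaginary axis -/

/-- **`landauField_mem_real` FIRES ON THE MODEL**: for every real chart point `‖y‖ ≤ 1` the exponent field is IMAGINARY,
`toyZu y ∈ iℝ` — every binder of file (A) §3 inhabited by the `𝔲(1)` data. [folklore] -/
theorem toy_real : ∀ y : Fin 1 → ℝ, ‖y‖ ≤ 1 → toyZu y ∈ (imagAxis : Set ℂ) := by
  intro y hy
  obtain ⟨hΦd, hΦ0, hΦ⟩ := toy_chartMap
  obtain ⟨hCq, hCd⟩ := toy_sectC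
  obtain ⟨h𝒢r, hWr, hιr, hHr, hCr, hH₁r, hΦr⟩ := toy_realStructure
  exact landauField_mem_real (𝒢 := ContinuousLinearMap.id ℂ ℂ) (W𝒱 := fun _ : ℂ => (0 : ℂ)) (b := 1 / 50)
    (ε₄ := 1 / 1000) toy_id_bound toy_prop4 one_pos le_rfl (by norm_num) (by norm_num) (by norm_num) (by norm_num)
    mulI mulI_bound hΦ (by norm_num : (1 : ℝ) < 200) zero_le_one hCq hCd (ContinuousLinearMap.id ℂ ℂ)
    (fun Y => by simp) mulI mulI_bound (by norm_num) (by norm_num) imagAxis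
    (isClosed_eq Complex.continuous_re continuous_const) imagAxis imagAxis realAxis
    (isClosed_eq Complex.continuous_im continuous_const) realAxis h𝒢r hWr hιr hHr hCr hH₁r hΦr hy

/-! ## §3 File (B) fires: END-II's `hGW` for the model's weight word -/

/-- **`hGW_landau_chartRay` FIRES ON THE MODEL**: every binder inhabited (window `closedBall 0 1`, `S = 1`, `r_Φ = 200`,
one weight plaquette with read-out `[id]`, `κ_w = 1`, `m_w = 1`, trace datum `Re`, real structure `iℝ`/`ℝ`, unitarity
type §1); conclusion = END-II's `hGW` for the DEFINED weight word `holOf [id] toyZu`, sizes `s̄ = z̄`, `L̄ = 3z̄/199`,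
`d̄ = 0`, `z̄ = 0.021 + 4·0.021² = 0.022764`. [folklore] -/
theorem toy_hGW :
    ∀ x ∈ closedBall (0 : Fin 1 → ℝ) 1, ∀ p ∈ ({()} : Finset Unit), ∃ gw : List (MLetter ℂ × ℝ × ℝ),
      (∀ y ∈ gw, y.1.Good complexTrace.τ y.2.1 y.2.2) ∧
      sSum gw ≤ (1 : ℕ) * (1 * ((1 / 1000 + 1 * (1 / 50)) + 1 * (4 * 1 * (1 / 1000 + 1 * (1 / 50)) ^ 2))) ∧
      lSum gw ≤ (1 : ℕ) * (3 * (1 * ((1 / 1000 + 1 * (1 / 50)) + 1 * (4 * 1 * (1 / 1000 + 1 * (1 / 50)) ^ 2))) /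
        (200 / 1 - 1)) ∧
      mdFro (gw.map Prod.fst) ≤ 0 ∧
      ∀ c' : ℝ, 0 ≤ c' → c' ≤ 1 → mwordEval c' (gw.map Prod.fst) = holOf [ContinuousLinearMap.id ℂ ℂ] toyZu (c' • x) := by
  obtain ⟨hΦd, hΦ0, hΦ⟩ := toy_chartMap
  obtain ⟨hCq, hCd⟩ := toy_sectC
  obtain ⟨h𝒢r, hWr, hιr, hHr, hCr, hH₁r, hΦr⟩ := toy_realStructure
  exact hGW_landau_chartRay complexTrace (Pw := ({()} : Finset Unit)) (𝒢 := ContinuousLinearMap.id ℂ ℂ)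
    (W𝒱 := fun _ : ℂ => (0 : ℂ)) (b := 1 / 50) (ε₄ := 1 / 1000) one_pos Subset.rfl toy_id_bound toy_prop4 one_pos
    le_rfl (by norm_num) (by norm_num) (by norm_num) (by norm_num) mulI mulI_bound hΦd hΦ0 hΦ
    (by norm_num : (1 : ℝ) < 200) zero_le_one hCq hCd (ContinuousLinearMap.id ℂ ℂ) (fun Y => by simp) mulI mulI_bound
    (by norm_num) (by norm_num) (fun _ => [ContinuousLinearMap.id ℂ ℂ]) zero_le_one
    (fun _ _ ℓ hℓ Y => by rw [List.mem_singleton] at hℓ; subst hℓ; simp) (m := 1) (fun _ _ => by simp)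
    imagAxis (isClosed_eq Complex.continuous_re continuous_const) imagAxis imagAxis realAxis
    (isClosed_eq Complex.continuous_im continuous_const) realAxis h𝒢r hWr hιr hHr hCr hH₁r hΦr
    toy_unitary

/-! ## §4 File (D) fires: END-II's `hE` for the model's non-Wilson term -/

/-- **`hE_landau_chartRay` FIRES ON THE MODEL** with ONE term functional `𝓔₁ = id` on `ball 0 1` (`e₁ = 1`, `H̄ = 2`) and
the coupling `z̄ = 0.022764 ≤ 1 = r_E`: END-II's `hE` for the DEFINED term `y ↦ Re (toyZu y)`, `B_𝓔 = 3·2/199`.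
[folklore] -/
theorem toy_hE :
    ∀ x ∈ closedBall (0 : Fin 1 → ℝ) 1, ∀ c' : ℝ, 1 / 2 ≤ c' → c' ≤ 1 →
      (fun y => (∑ i ∈ ({()} : Finset Unit), (fun (_ : Unit) (Z : ℂ) => Z) i (toyZu y)).re) (c' • x) ≤
      (fun y => (∑ i ∈ ({()} : Finset Unit), (fun (_ : Unit) (Z : ℂ) => Z) i (toyZu y)).re) x +
        (1 - c') * (3 * 2 / (200 / 1 - 1)) := by
  obtain ⟨hΦd, hΦ0, hΦ⟩ := toy_chartMap
  obtain ⟨hCq, hCd⟩ := toy_sectC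
  exact hE_landau_chartRay (𝒢 := ContinuousLinearMap.id ℂ ℂ) (W𝒱 := fun _ : ℂ => (0 : ℂ)) (b := 1 / 50)
    (ε₄ := 1 / 1000) one_pos Subset.rfl toy_id_bound toy_prop4 one_pos le_rfl (by norm_num) (by norm_num) (by norm_num)
    (by norm_num) mulI mulI_bound hΦd hΦ0 hΦ (by norm_num : (1 : ℝ) < 200) zero_le_one hCq hCd
    (ContinuousLinearMap.id ℂ ℂ) (fun Y => by simp) mulI mulI_bound (by norm_num) (by norm_num) ({()} : Finset Unit)
    (Ef := fun (_ : Unit) (Z : ℂ) => Z) (rE := 1) (e := fun _ => 1) (Hbar := 2)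
    (fun _ _ => differentiableOn_id) (fun _ _ Z hZ => (mem_ball_zero_iff.1 hZ).le) (by simp) (by norm_num)

/-! ## §5 A live shell point inside the window -/

/-- with `W = 0`, `J = 0`, `Λ = 0` the zero configuration is THE solution, so the exponent field at a chart point is
`toyZu y = i y₀/10⁴ − i D(i y₀/10⁴)`. [folklore] -/
theorem toyZu_eq (y : Fin 1 → ℝ) :
    toyZu y = mulI (toyΦ (cplx y)) -
      mulI (corrAt (fun Z : ℂ => Z ^ 2) (ContinuousLinearMap.id ℂ ℂ) mulI (4 * 1 * (1 / 1000 + 1 * (1 / 50)) ^ 2)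
        (mulI (toyΦ (cplx y)))) := by
  rw [toyZu, landauExp_apply, toy_solAt, zero_add]

/-- **(55) at the window point**: `‖D(i·10⁻⁴)‖ ≤ 4·‖i·10⁻⁴‖²`, through `corrAt_along` (constant curve). [folklore] -/
theorem toy_corrAt_le_u :
    ‖corrAt (fun Z : ℂ => Z ^ 2) (ContinuousLinearMap.id ℂ ℂ) mulI (4 * 1 * (1 / 1000 + 1 * (1 / 50) : ℝ) ^ 2)
        (mulI (1 / 10000 : ℂ))‖ ≤ 4 * 1 * ‖(ContinuousLinearMap.id ℂ ℂ) (mulI (1 / 10000 : ℂ))‖ ^ 2 := by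
  obtain ⟨hCq, hCd⟩ := toy_sectC
  have h := corrAt_along (Rad := 1) zero_le_one hCq hCd (ContinuousLinearMap.id ℂ ℂ) (fun Y => by simp) mulI
    zero_le_one mulI_bound (ε := (1 / 1000 + 1 * (1 / 50) : ℝ)) (by norm_num) (by norm_num)
    (Y := fun _ : ℂ => mulI (1 / 10000 : ℂ)) (differentiableOn_const _) (fun _ _ => by simp; norm_num)
  exact (h.2 0 (mem_ball_self one_pos)).2.2.2

/-- **A LIVE SHELL POINT IN THE WINDOW.**  With `θ = 10⁻⁴`, `ρ = 1/4`: the window point `x₀ = 1` satisfies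
`θ(1−ρ) ≤ ‖hol x₀ − 1‖` for the classifier holonomy `holOf [id] toyZu` — the threshold scale is REACHED inside the
window, so the END's (M1) is not vacuous there. [folklore] -/
theorem toy_live_u : ∃ x ∈ closedBall (0 : Fin 1 → ℝ) 1, ∃ p ∈ ({()} : Finset Unit),
    (1 / 10000 : ℝ) * (1 - 1 / 4) ≤ ‖holOf [ContinuousLinearMap.id ℂ ℂ] toyZu x - 1‖ := by
  refine ⟨fun _ => 1, ?_, (), Finset.mem_singleton_self _, ?_⟩
  · rw [mem_closedBall_zero_iff]
    exact (pi_norm_le_iff_of_nonneg zero_le_one).2 fun _ => by simp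
  have hΦ1 : toyΦ (cplx fun _ : Fin 1 => (1 : ℝ)) = (1 / 10000 : ℂ) := by simp [cplx]
  have hhol : holOf [ContinuousLinearMap.id ℂ ℂ] toyZu (fun _ => 1) =
      exp (mulI (1 / 10000 : ℂ) - mulI (corrAt (fun Z : ℂ => Z ^ 2) (ContinuousLinearMap.id ℂ ℂ) mulI
        (4 * 1 * (1 / 1000 + 1 * (1 / 50) : ℝ) ^ 2) (mulI (1 / 10000 : ℂ)))) := by
    rw [holOf_apply, toyZu_eq, hΦ1]
    simp only [List.map_cons, List.map_nil, wordExp, List.prod_cons, List.prod_nil, mul_one,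
      ContinuousLinearMap.coe_id', id_eq]
  rw [hhol]
  set D := corrAt (fun Z : ℂ => Z ^ 2) (ContinuousLinearMap.id ℂ ℂ) mulI (4 * 1 * (1 / 1000 + 1 * (1 / 50) : ℝ) ^ 2)
    (mulI (1 / 10000 : ℂ)) with hD
  have hDle : ‖D‖ ≤ 4 / 100000000 := by
    have h := toy_corrAt_le_u
    have hn : ‖(ContinuousLinearMap.id ℂ ℂ) (mulI (1 / 10000 : ℂ))‖ = 1 / 10000 := by simp
    rw [hn] at h
    have h4 : (4 : ℝ) * 1 * (1 / 10000) ^ 2 = 4 / 100000000 := by norm_num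
    rw [h4] at h
    exact h
  -- the exponent `w = i·10⁻⁴ − i·D = i·(10⁻⁴ − D)`
  have hw : mulI (1 / 10000 : ℂ) - mulI D = Complex.I * ((1 / 10000 : ℂ) - D) := by
    rw [mulI_apply, mulI_apply, mul_sub]
  have hnw : ‖mulI (1 / 10000 : ℂ) - mulI D‖ = ‖(1 / 10000 : ℂ) - D‖ := by
    rw [hw, norm_mul, Complex.norm_I, one_mul]
  have hA : ‖(1 / 10000 : ℂ)‖ = 1 / 10000 := by simp
  have hlo : 1 / 10000 - 4 / 100000000 ≤ ‖(1 / 10000 : ℂ) - D‖ := by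
    have := norm_sub_norm_le (1 / 10000 : ℂ) D
    rw [hA] at this
    linarith
  have hhi : ‖(1 / 10000 : ℂ) - D‖ ≤ 1 / 10000 + 4 / 100000000 := by
    have := norm_sub_le (1 / 10000 : ℂ) D
    rw [hA] at this
    linarith
  have hw1 : ‖mulI (1 / 10000 : ℂ) - mulI D‖ ≤ 1 := by rw [hnw]; linarith
  have hge := norm_exp_sub_one_ge hw1
  rw [hnw] at hge
  have hsq : ‖(1 / 10000 : ℂ) - D‖ ^ 2 ≤ (1 / 10000 + 4 / 100000000) ^ 2 :=
    pow_le_pow_left₀ (norm_nonneg _) hhi 2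
  nlinarith

/-! ## §6 (SM) and the weight smallness -/

/-- **(SM) ON THE MODEL** — the same inequality as gen 3's `ShellMeasureLandauHolonomyToy.toy_SM` (same `H_AN`, `δ = 1/2`,
`θ = 10⁻⁴`, `Rad = 200`), restated in the currency of files (C)/(D) (`κ = 1`, `B₀ = 1`, `C₂ = 1`). [folklore] -/
theorem toy_SM_u :
    36 * (Real.exp ((1 : ℕ) * (1 * ((1 / 1000 + 1 * (1 / 50)) + 1 * (4 * 1 * (1 / 1000 + 1 * (1 / 50)) ^ 2)))) - 1) *
        1 ^ 2 / (200 / 1 - 1) ^ 2 ≤ (1 / 2) * (1 / 10000 : ℝ) := by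
  rw [one_pow, mul_one]
  exact ShellMeasureLandauHolonomyToy.toy_SM

/-- **END-II's `hsw1` ON THE MODEL**: `m_w κ_w z̄ = 0.022764 ≤ 1`. [folklore] -/
theorem toy_sw1 :
    ((1 : ℕ) : ℝ) * (1 * ((1 / 1000 + 1 * (1 / 50)) + 1 * (4 * 1 * (1 / 1000 + 1 * (1 / 50)) ^ 2))) ≤ 1 := by
  norm_num

end Summit.QuantumFields.BalabanUV.T4Continuum.ShellMeasureLandauHolonomyRealToy
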